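/-
Copyright (c) 2026 the pub-hodgecm-mathlib formalisation cell (harness21).  Prover seat hodgecm-mathlib-K2Liu-p14 (g3), Track B «K2-LIT»,
#184♮ = hLiu418 = `stmt-HodgeConjecture-24832`; Road I v3, S5-F3 lineage ∕ I4-conv, THE CARRIER LETTER (A): term 2 of the Klingen constant term (★ F10) on the doubled LINE.
-/
import Summits.HodgeConjecture.HodgeConjecture.Theorems.K2LiuKlingenInnerSectionE1Law        -- ★ F8: `innerSection_borel_law` (+ ★ bridge parts 1–2, ★ `K2E1BorelEisensteinGodementU2`, ★ E1 `eisensteinSeriesU`)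
import Summits.HodgeConjecture.HodgeConjecture.Theorems.K2LiuKlingenInnerSectionAutomorphy   -- ★ F5-q: `exists_const_innerSectionOrbit_eq`, ★ F5-p `toAdelic_weylXi_eq_jAdelic`
import Summits.HodgeConjecture.HodgeConjecture.Theorems.K2E1BorelIntertwiningU2FromK2Liu      -- ★ part 3b: `bridge_congr_over` (discharges `hc`), `congr_mem_unipDelta_iff_mem_adelicUnipotent` (`N ↦ N_Δ`)
import HarnessLib

/-!
# Crux `HLiu418`, Road I v3, S5-F3 ∕ I4-conv — file `K2LiuKlingenTermTwoTransport`: THE CARRIER LETTER (A) —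
# term 2 of `CT_Q(E^Δ(f))` (★ F10: the Borel Eisenstein series `eisensteinSeriesU F_h` of `U(J₂)`) IS a Siegel–hermitian Eisenstein series
# `E^Δ_{n=1}(F′_h ∘ Ψ_S⁻¹)(Ψ_S g₂)` of the doubled LINE `H₁ = U(𝕍₁ ⊕ −𝕍₁)`, `𝕍₁ = (L, 1)`

Cell `hodgecm-mathlib`, crux item hLiu418 = `stmt-HodgeConjecture-24832`; squad K2 ∕ K2Liu; LEAD F0P6-plan (g14) BATCH #31 (1) «(T4) carrier A → p14» ∕ co-dealer
K2E5-plan (g7) 14:22:38Z (B); prover K2Liu-p14 (g3) (g2 HANDOFF §NEXT (1)).  THEOREMS ONLY (no `def`, no instance, no notation, no named-fact hypothesis, no `sorry`);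
lane `--supports stmt-HodgeConjecture-24832 --as helper` (count-neutral).
THE SEAM.  ★ F10 `klingenConstTerm_eq_eisensteinSeriesU_add` writes the second term `T₂ = eisensteinSeriesU F_h g₂` on Mok's datum
`quasiSplit L⁺ L c 2 = adelicGroupData L⁺ L c 2 ((StdForm.antidiagonal 2).over L)` (★ E1 `K2E1BorelEisensteinUDefs`), while the ★ K2Liu junction at `n = 1`
(★ `K2E1BorelEisensteinU2FromK2Liu{,Transport}`: `Ψ_S = adelicUnitaryGroupCongr L S J^𝔻 Φ₂ (bridge_congr L S hS)`, `S = (1 ½; 1 −½)`) is typed on the LITERAL form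
`Φ₂ = Matrix.of (i j ↦ [i+j+1 = 2])` with the proof term `bridge_congr L S hS` INSIDE its statements.  Here every dictionary item is re-issued for a GENERIC form `J`
under the binders `(hJ : Matrix.of … = J)` and an ARBITRARY congruence proof `(hc : (S.map c)ᵀ · J^𝔻 · S = J)` (`subst hJ`; proof irrelevance identifies `hc` with
`bridge_congr L S hS`), and then instantiated at `J := (StdForm.antidiagonal 2).over L`, `hJ := ★ antidiagOne_eq_over` — so the heads land LITERALLY in F10's tokens
`(quasiSplit (Fp L) L (IsCMField.complexConj L) 2).Adelic`, `eisensteinSeriesU`, with `Ψ_S := adelicUnitaryGroupCongr L S J^𝔻 ((StdForm.antidiagonal 2).over L) hc`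
(`hc` discharged by ★ part 3b `K2E1BorelIntertwiningU2FromK2Liu.bridge_congr_over`, whose `congr_mem_unipDelta_iff_mem_adelicUnipotent` already carries `N(𝔸)` onto `N_Δ(𝔸)`).

* §2 (generic `J`) `isSiegelDelta_congr_iff` (`Ψ_S g ∈ P_Δ(𝔸) ↔ g₁₀ = 0`), `detDelta_congr_eq` (`det_Δ(Ψ_S b) = b₀₀` for `b₁₀ = 0`), `congr_toAdelic_mem_ratH`,
  `congr_symm_mem_range_toAdelic` (rational points `U(J)(L⁺) ↔ H₁(L⁺)`), `isSiegelDeltaSection_comp_congr_symm` (Borel sections of `I(s,χ)` ↦ Siegel sections of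
  `I_Δ(s,χ)` at `n = 1`), `eisensteinSeriesU_eq_eisensteinSeriesDelta_congr` (`E_B(F)(g) = E^Δ(F ∘ Ψ_S⁻¹)(Ψ_S g)`, any `s`, `χ`, no convergence needed).
* §3 (`J = (StdForm.antidiagonal 2).over L`) the same six, suffix `bridgeOver`: …, `isSiegelDeltaSection_comp_bridgeOver_symm`, **`eisensteinSeriesU_eq_eisensteinSeriesDelta`**.
* §4 THE INSTANCE on ★ F10 ∕ ★ F8 ∕ ★ F5-q's letters (`Ψ : U(J₄)(𝔸) ≃ₜ* H(𝔸)` pinned by `hΨ`, `f ∈ I_Δ(s,χ)` a continuous Siegel section, `h ∈ H(𝔸)`):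
  **`isSiegelDeltaSection_innerSection_comp_bridgeOver_symm`** — the inner section `F′_h(y) = ∫ f(Ψ(ξ)·Ψ(n_Q(q))·Ψ(m_Q(1, j₂⁻¹y))·h) d(μ_Y × μ_T)` of term 2, pulled back
  along `Ψ_S⁻¹`, is a Siegel section of `I_Δ(s − ½, χ)` of the LINE (★ F8 `innerSection_borel_law` = the Borel law at E1 parameter `s − ½`);
  **`eisensteinSeriesU_innerSection_eq_eisensteinSeriesDelta`** — `eisensteinSeriesU F′_h g₂ = E^Δ_{n=1}(F′_h ∘ Ψ_S⁻¹)(Ψ_S g₂)`;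
  **`exists_const_eisensteinSeriesU_innerSectionOrbit_eq`** — for F10's OWN section `F_h(y) = ∫ β₁(u) • f(Ψ(ξ_L)·u·Ψ(m_Q(1, j₂⁻¹y))·h) dνN(u)` (orbit form):
  `∃ C ≠ ∞, ∀ h g₂, eisensteinSeriesU F_h g₂ = C · E^Δ_{n=1}(F′_h ∘ Ψ_S⁻¹)(Ψ_S g₂)` (★ F5-q `exists_const_innerSectionOrbit_eq`: ONE constant for all `h`, `g₂`).
Downstream of I4 (★ Φ1 `fourierCoeffDelta`, ★ Φ3d, ★ W3-b∕c∕d, ★ S5-F2, ★ S5 TOP) everything applies VERBATIM at `n := 1` to `φ := E^Δ_{n=1}(F′_h ∘ Ψ_S⁻¹)`.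
[MoeglinWaldspurger1995, II.1.5, II.1.7], [Tan1999, §1], [GelbartRogawski1991, §3.1], [PlatonovRapinchuk1994, §2.3], [GanTakeda2011SiegelWeil, §7.2 p. 23].  HONEST LABEL.
Count-neutral helper: `HC_CM` is proved only modulo the 7 printed citations (2 remaining named inputs: hLiu418 = `stmt-HodgeConjecture-24832`, h413 = `stmt-HodgeConjecture-24833`)
until rung 0 closes.
-/

set_option autoImplicit false
set_option linter.dupNamespace false -- the mandated namespace repeats `HodgeConjecture.HodgeConjecture`

noncomputable section

open scoped Matrix ENNReal NNReal
open NumberField IsDedekindDomain MeasureTheory MeasureTheory.Measure MulAction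

namespace Summit.HodgeConjecture.HodgeConjecture.Cruxes.HLiu418.K2LiuKlingenTermTwoTransport

open Literature.MeasureTheory.Group
open Literature.NumberTheory.Automorphic Literature.NumberTheory.Automorphic.UnitaryGroup
open Literature.NumberTheory.GelbartRogawski1991 Literature.NumberTheory.GelbartRogawski1991.GRConstruction
open Literature.NumberTheory.GaloisRepresentations
open Literature.NumberTheory.K2Lit.SiegelDoubled
open Summit.HodgeConjecture.HodgeConjecture.Cruxes.H413.K2E1BorelEisensteinU2FromK2Liu
open Summit.HodgeConjecture.HodgeConjecture.Cruxes.H413.K2E1BorelEisensteinU2FromK2LiuTransport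
open Summit.HodgeConjecture.HodgeConjecture.Cruxes.H413.K2E1BorelIntertwiningU2FromK2Liu (bridge_congr_over)
open Summit.HodgeConjecture.HodgeConjecture.Cruxes.H413.K2E1BorelEisensteinU (eisensteinSeriesU eisensteinSeriesU_def eisensteinSeriesU_smul)
open Summit.HodgeConjecture.HodgeConjecture.Cruxes.HLiu418.K2LiuDoubledUTwoTwoBorelFrame Summit.HodgeConjecture.HodgeConjecture.Cruxes.HLiu418.K2LiuKlingenParabolicDefs
open Summit.HodgeConjecture.HodgeConjecture.Cruxes.HLiu418.K2LiuKlingenUnipotentDefs Summit.HodgeConjecture.HodgeConjecture.Cruxes.HLiu418.K2LiuKlingenUnipotentAdelicDefs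
open Summit.HodgeConjecture.HodgeConjecture.Cruxes.HLiu418.K2LiuKlingenRationalCells (complexConj_ringHom_apply_apply)
open Summit.HodgeConjecture.HodgeConjecture.Cruxes.HLiu418.K2LiuKlingenInnerSectionE1Law (innerSection_borel_law)
open Summit.HodgeConjecture.HodgeConjecture.Cruxes.HLiu418.K2LiuKlingenInnerSectionAutomorphy (exists_const_innerSectionOrbit_eq)
open Summit.HodgeConjecture.HodgeConjecture.Cruxes.HLiu418.K2LiuKlingenInnerSectionBorelInvariant (toAdelic_weylXi_eq_jAdelic)
open Summit.HodgeConjecture.HodgeConjecture.Cruxes.HLiu418.K2LiuSiegelDoubledLeviMatrix (conjAdele_conjAdele')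
open UnitaryDualPair

/-! ## §2 The dictionary for a generic form `J` congruent to `diag(1,−1)` along `S` (instantiated in §3; `hc` for §3 is ★ `bridge_congr_over L S hS`) -/

section Generic

variable (L : Type) [Field L] [NumberField L] [IsCMField L]

/-- **BOREL `↦` SIEGEL PARABOLIC, generic form**: `Ψ_S g ∈ P_Δ(𝔸) ↔ g₁₀ = 0` (★ `isSiegelDelta_bridge_iff`, `J` generic). [cite: GelbartRogawski1991, §3.1] [cite: Tan1999, §1] -/
theorem isSiegelDelta_congr_iff {J : Matrix (Fin 2) (Fin 2) L} (hJ : (Matrix.of fun i j : Fin 2 => if i.val + j.val + 1 = 2 then (1 : L) else 0) = J)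
    (S : GL (Fin 2) L) (hS : (S : Matrix (Fin 2) (Fin 2) L) = !![1, 2⁻¹; 1, -2⁻¹]) (hS' : ((S⁻¹ : GL (Fin 2) L) : Matrix (Fin 2) (Fin 2) L) = !![2⁻¹, 2⁻¹; 1, -1])
    (hc : ((S : Matrix (Fin 2) (Fin 2) L).map (cmConjRingHom L))ᵀ *
        hermD L (Equiv.prodUnique (Fin 1) (Fin 1)) (fun _ => (1 : L)) (fun _ => map_one _) (fun _ => (1 : L)) (fun _ => map_one _) * (S : Matrix (Fin 2) (Fin 2) L) = J)
    (g : (adelicGroupData (Fp L) L (IsCMField.complexConj L) 2 J).Adelic) :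
    IsSiegelDelta L (Equiv.prodUnique (Fin 1) (Fin 1)) (fun _ => (1 : L)) (fun _ => map_one _) (fun _ => (1 : L)) (fun _ => map_one _)
        (adelicUnitaryGroupCongr L S _ J hc g) ↔
      ((g.1 : GL (Fin 2) (AdeleRing (𝓞 L) L)) : Matrix (Fin 2) (Fin 2) (AdeleRing (𝓞 L) L)) 1 0 = 0 := by
  subst hJ
  exact isSiegelDelta_bridge_iff L S hS hS' g

/-- **`det_Δ(Ψ_S b) = b₀₀` on the Borel, generic form** (★ `detDelta_bridge`). [cite: Tan1999, §1] [cite: MoeglinWaldspurger1995, I.1.4] -/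
theorem detDelta_congr_eq {J : Matrix (Fin 2) (Fin 2) L} (hJ : (Matrix.of fun i j : Fin 2 => if i.val + j.val + 1 = 2 then (1 : L) else 0) = J)
    (S : GL (Fin 2) L) (hS : (S : Matrix (Fin 2) (Fin 2) L) = !![1, 2⁻¹; 1, -2⁻¹]) (hS' : ((S⁻¹ : GL (Fin 2) L) : Matrix (Fin 2) (Fin 2) L) = !![2⁻¹, 2⁻¹; 1, -1])
    (hc : ((S : Matrix (Fin 2) (Fin 2) L).map (cmConjRingHom L))ᵀ *
        hermD L (Equiv.prodUnique (Fin 1) (Fin 1)) (fun _ => (1 : L)) (fun _ => map_one _) (fun _ => (1 : L)) (fun _ => map_one _) * (S : Matrix (Fin 2) (Fin 2) L) = J)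
    (b : (adelicGroupData (Fp L) L (IsCMField.complexConj L) 2 J).Adelic)
    (hb : ((b.1 : GL (Fin 2) (AdeleRing (𝓞 L) L)) : Matrix (Fin 2) (Fin 2) (AdeleRing (𝓞 L) L)) 1 0 = 0) :
    detDelta L (Equiv.prodUnique (Fin 1) (Fin 1)) (fun _ => (1 : L)) (fun _ => map_one _) (fun _ => (1 : L)) (fun _ => map_one _)
        (adelicUnitaryGroupCongr L S _ J hc b) =
      ((b.1 : GL (Fin 2) (AdeleRing (𝓞 L) L)) : Matrix (Fin 2) (Fin 2) (AdeleRing (𝓞 L) L)) 0 0 := by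
  subst hJ
  exact detDelta_bridge L S hS hS' b hb

/-- **`Ψ_S` maps rational points to rational points, generic form**: `Ψ_S(γ_𝔸) ∈ H₁(L⁺)` for `γ ∈ U(J)(L⁺)` (★ `bridge_mem_ratH`). [cite: PlatonovRapinchuk1994, §2.3] -/
theorem congr_toAdelic_mem_ratH {J : Matrix (Fin 2) (Fin 2) L} (hJ : (Matrix.of fun i j : Fin 2 => if i.val + j.val + 1 = 2 then (1 : L) else 0) = J)
    (S : GL (Fin 2) L) (hS : (S : Matrix (Fin 2) (Fin 2) L) = !![1, 2⁻¹; 1, -2⁻¹])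
    (hc : ((S : Matrix (Fin 2) (Fin 2) L).map (cmConjRingHom L))ᵀ *
        hermD L (Equiv.prodUnique (Fin 1) (Fin 1)) (fun _ => (1 : L)) (fun _ => map_one _) (fun _ => (1 : L)) (fun _ => map_one _) * (S : Matrix (Fin 2) (Fin 2) L) = J)
    (γ : (adelicGroupData (Fp L) L (IsCMField.complexConj L) 2 J).Rational) :
    (adelicUnitaryGroupCongr L S _ J hc ((adelicGroupData (Fp L) L (IsCMField.complexConj L) 2 J).toAdelic γ) :
        HA L (Equiv.prodUnique (Fin 1) (Fin 1)) (fun _ => (1 : L)) (fun _ => map_one _) (fun _ => (1 : L)) (fun _ => map_one _)) ∈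
      ratH L (Equiv.prodUnique (Fin 1) (Fin 1)) (fun _ => (1 : L)) (fun _ => map_one _) (fun _ => (1 : L)) (fun _ => map_one _) := by
  subst hJ
  exact bridge_mem_ratH L S hS ⟨γ, rfl⟩

/-- **… and `Ψ_S⁻¹` maps `H₁(L⁺)` into `U(J)(L⁺)`, generic form** (★ `bridge_symm_mem_arithmeticSubgroup`). [cite: PlatonovRapinchuk1994, §2.3] -/
theorem congr_symm_mem_range_toAdelic {J : Matrix (Fin 2) (Fin 2) L} (hJ : (Matrix.of fun i j : Fin 2 => if i.val + j.val + 1 = 2 then (1 : L) else 0) = J)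
    (S : GL (Fin 2) L) (hS : (S : Matrix (Fin 2) (Fin 2) L) = !![1, 2⁻¹; 1, -2⁻¹])
    (hc : ((S : Matrix (Fin 2) (Fin 2) L).map (cmConjRingHom L))ᵀ *
        hermD L (Equiv.prodUnique (Fin 1) (Fin 1)) (fun _ => (1 : L)) (fun _ => map_one _) (fun _ => (1 : L)) (fun _ => map_one _) * (S : Matrix (Fin 2) (Fin 2) L) = J)
    {δ : HA L (Equiv.prodUnique (Fin 1) (Fin 1)) (fun _ => (1 : L)) (fun _ => map_one _) (fun _ => (1 : L)) (fun _ => map_one _)}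
    (hδ : δ ∈ ratH L (Equiv.prodUnique (Fin 1) (Fin 1)) (fun _ => (1 : L)) (fun _ => map_one _) (fun _ => (1 : L)) (fun _ => map_one _)) :
    ∃ γ : (adelicGroupData (Fp L) L (IsCMField.complexConj L) 2 J).Rational,
      (adelicGroupData (Fp L) L (IsCMField.complexConj L) 2 J).toAdelic γ = (adelicUnitaryGroupCongr L S _ J hc).symm δ := by
  subst hJ
  exact bridge_symm_mem_arithmeticSubgroup L S hS hδ

/-- **BOREL SECTIONS ARE SIEGEL SECTIONS AT `n = 1`, generic form**: if `F(b g) = χ(u) · (√‖u‖)^{2s+1} · F(g)` whenever `b₁₀ = 0`, `u = b₀₀`, then `F ∘ Ψ_S⁻¹` is a Siegel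
section of `I_Δ(s, χ)` of the doubled line (★ `isSiegelDeltaSection_comp_bridge_symm`). [cite: Tan1999, §1] [cite: MoeglinWaldspurger1995, I.1.4, II.1.5] -/
theorem isSiegelDeltaSection_comp_congr_symm {J : Matrix (Fin 2) (Fin 2) L} (hJ : (Matrix.of fun i j : Fin 2 => if i.val + j.val + 1 = 2 then (1 : L) else 0) = J)
    (S : GL (Fin 2) L) (hS : (S : Matrix (Fin 2) (Fin 2) L) = !![1, 2⁻¹; 1, -2⁻¹]) (hS' : ((S⁻¹ : GL (Fin 2) L) : Matrix (Fin 2) (Fin 2) L) = !![2⁻¹, 2⁻¹; 1, -1])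
    (hc : ((S : Matrix (Fin 2) (Fin 2) L).map (cmConjRingHom L))ᵀ *
        hermD L (Equiv.prodUnique (Fin 1) (Fin 1)) (fun _ => (1 : L)) (fun _ => map_one _) (fun _ => (1 : L)) (fun _ => map_one _) * (S : Matrix (Fin 2) (Fin 2) L) = J)
    (χ : HeckeCharacter L) (s : ℂ) {F : (adelicGroupData (Fp L) L (IsCMField.complexConj L) 2 J).Adelic → ℂ}
    (hF : ∀ (b g : (adelicGroupData (Fp L) L (IsCMField.complexConj L) 2 J).Adelic) (u : (AdeleRing (𝓞 L) L)ˣ),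
      ((b.1 : GL (Fin 2) (AdeleRing (𝓞 L) L)) : Matrix (Fin 2) (Fin 2) (AdeleRing (𝓞 L) L)) 1 0 = 0 →
      (u : AdeleRing (𝓞 L) L) = ((b.1 : GL (Fin 2) (AdeleRing (𝓞 L) L)) : Matrix (Fin 2) (Fin 2) (AdeleRing (𝓞 L) L)) 0 0 →
        F (b * g) = ((χ u : ℂˣ) : ℂ) * ((Real.sqrt (ideleNorm u) : ℝ) : ℂ) ^ (2 * s + 1) * F g) :
    IsSiegelDeltaSection L (Equiv.prodUnique (Fin 1) (Fin 1)) (fun _ => (1 : L)) (fun _ => map_one _) (fun _ => (1 : L)) (fun _ => map_one _) χ s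
      (fun x => F ((adelicUnitaryGroupCongr L S _ J hc).symm x)) := by
  subst hJ
  exact isSiegelDeltaSection_comp_bridge_symm L S hS hS' χ s hF

/-- **`E_B(F)(g) = E^Δ(F ∘ Ψ_S⁻¹)(Ψ_S g)`, generic form**: the Borel Eisenstein series ★ `eisensteinSeriesU F` of `U(J)` IS the Siegel–hermitian Eisenstein series
★ `eisensteinSeriesDelta` of the doubled line, for every Borel section `F` of `I(s,χ)` (any `s`, `χ`; pure `tsum` re-indexing, ★ `borelEisenstein_eq_eisensteinSeriesDelta`).
[cite: Tan1999, §1] [cite: MoeglinWaldspurger1995, II.1.5] -/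
theorem eisensteinSeriesU_eq_eisensteinSeriesDelta_congr {J : Matrix (Fin 2) (Fin 2) L}
    (hJ : (Matrix.of fun i j : Fin 2 => if i.val + j.val + 1 = 2 then (1 : L) else 0) = J)
    (S : GL (Fin 2) L) (hS : (S : Matrix (Fin 2) (Fin 2) L) = !![1, 2⁻¹; 1, -2⁻¹]) (hS' : ((S⁻¹ : GL (Fin 2) L) : Matrix (Fin 2) (Fin 2) L) = !![2⁻¹, 2⁻¹; 1, -1])
    (hc : ((S : Matrix (Fin 2) (Fin 2) L).map (cmConjRingHom L))ᵀ *
        hermD L (Equiv.prodUnique (Fin 1) (Fin 1)) (fun _ => (1 : L)) (fun _ => map_one _) (fun _ => (1 : L)) (fun _ => map_one _) * (S : Matrix (Fin 2) (Fin 2) L) = J)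
    (χ : HeckeCharacter L) (s : ℂ) {F : (adelicGroupData (Fp L) L (IsCMField.complexConj L) 2 J).Adelic → ℂ}
    (hF : ∀ (b g : (adelicGroupData (Fp L) L (IsCMField.complexConj L) 2 J).Adelic) (u : (AdeleRing (𝓞 L) L)ˣ),
      ((b.1 : GL (Fin 2) (AdeleRing (𝓞 L) L)) : Matrix (Fin 2) (Fin 2) (AdeleRing (𝓞 L) L)) 1 0 = 0 →
      (u : AdeleRing (𝓞 L) L) = ((b.1 : GL (Fin 2) (AdeleRing (𝓞 L) L)) : Matrix (Fin 2) (Fin 2) (AdeleRing (𝓞 L) L)) 0 0 →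
        F (b * g) = ((χ u : ℂˣ) : ℂ) * ((Real.sqrt (ideleNorm u) : ℝ) : ℂ) ^ (2 * s + 1) * F g)
    (g : (adelicGroupData (Fp L) L (IsCMField.complexConj L) 2 J).Adelic) :
    eisensteinSeriesU F g =
      eisensteinSeriesDelta L (Equiv.prodUnique (Fin 1) (Fin 1)) (fun _ => (1 : L)) (fun _ => map_one _) (fun _ => (1 : L)) (fun _ => map_one _)
        (fun x => F ((adelicUnitaryGroupCongr L S _ J hc).symm x)) (adelicUnitaryGroupCongr L S _ J hc g) := by
  subst hJ
  exact borelEisenstein_eq_eisensteinSeriesDelta L S hS hS' χ s hF g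

/-! ## §3 The dictionary in the campaign's tokens: `U(J₂) = quasiSplit L⁺ L c 2` -/

/-- **BOREL `↦` SIEGEL PARABOLIC on `U(J₂)`**: `Ψ_S g ∈ P_Δ(𝔸) ↔ g₁₀ = 0`. [cite: GelbartRogawski1991, §3.1] [cite: Tan1999, §1] -/
theorem isSiegelDelta_bridgeOver_iff
    (S : GL (Fin 2) L) (hS : (S : Matrix (Fin 2) (Fin 2) L) = !![1, 2⁻¹; 1, -2⁻¹]) (hS' : ((S⁻¹ : GL (Fin 2) L) : Matrix (Fin 2) (Fin 2) L) = !![2⁻¹, 2⁻¹; 1, -1])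
    (hc : ((S : Matrix (Fin 2) (Fin 2) L).map (cmConjRingHom L))ᵀ *
        hermD L (Equiv.prodUnique (Fin 1) (Fin 1)) (fun _ => (1 : L)) (fun _ => map_one _) (fun _ => (1 : L)) (fun _ => map_one _) * (S : Matrix (Fin 2) (Fin 2) L) =
      (StdForm.antidiagonal 2).over L)
    (g : (quasiSplit (Fp L) L (IsCMField.complexConj L) 2).Adelic) :
    IsSiegelDelta L (Equiv.prodUnique (Fin 1) (Fin 1)) (fun _ => (1 : L)) (fun _ => map_one _) (fun _ => (1 : L)) (fun _ => map_one _)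
        (adelicUnitaryGroupCongr L S _ _ hc g) ↔
      ((g.1 : GL (Fin 2) (AdeleRing (𝓞 L) L)) : Matrix (Fin 2) (Fin 2) (AdeleRing (𝓞 L) L)) 1 0 = 0 :=
  isSiegelDelta_congr_iff L (antidiagOne_eq_over (L := L) (N := 2)) S hS hS' hc g

/-- **`det_Δ(Ψ_S b) = b₀₀`** for `b ∈ U(J₂)(𝔸)` with `b₁₀ = 0`. [cite: Tan1999, §1] [cite: MoeglinWaldspurger1995, I.1.4] -/
theorem detDelta_bridgeOver_eq
    (S : GL (Fin 2) L) (hS : (S : Matrix (Fin 2) (Fin 2) L) = !![1, 2⁻¹; 1, -2⁻¹]) (hS' : ((S⁻¹ : GL (Fin 2) L) : Matrix (Fin 2) (Fin 2) L) = !![2⁻¹, 2⁻¹; 1, -1])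
    (hc : ((S : Matrix (Fin 2) (Fin 2) L).map (cmConjRingHom L))ᵀ *
        hermD L (Equiv.prodUnique (Fin 1) (Fin 1)) (fun _ => (1 : L)) (fun _ => map_one _) (fun _ => (1 : L)) (fun _ => map_one _) * (S : Matrix (Fin 2) (Fin 2) L) =
      (StdForm.antidiagonal 2).over L)
    (b : (quasiSplit (Fp L) L (IsCMField.complexConj L) 2).Adelic)
    (hb : ((b.1 : GL (Fin 2) (AdeleRing (𝓞 L) L)) : Matrix (Fin 2) (Fin 2) (AdeleRing (𝓞 L) L)) 1 0 = 0) :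
    detDelta L (Equiv.prodUnique (Fin 1) (Fin 1)) (fun _ => (1 : L)) (fun _ => map_one _) (fun _ => (1 : L)) (fun _ => map_one _)
        (adelicUnitaryGroupCongr L S _ _ hc b) =
      ((b.1 : GL (Fin 2) (AdeleRing (𝓞 L) L)) : Matrix (Fin 2) (Fin 2) (AdeleRing (𝓞 L) L)) 0 0 :=
  detDelta_congr_eq L (antidiagOne_eq_over (L := L) (N := 2)) S hS hS' hc b hb

/-- **`Ψ_S(γ_𝔸) ∈ H₁(L⁺)`** for `γ ∈ U(J₂)(L⁺)`. [cite: PlatonovRapinchuk1994, §2.3] -/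
theorem bridgeOver_toAdelic_mem_ratH
    (S : GL (Fin 2) L) (hS : (S : Matrix (Fin 2) (Fin 2) L) = !![1, 2⁻¹; 1, -2⁻¹])
    (hc : ((S : Matrix (Fin 2) (Fin 2) L).map (cmConjRingHom L))ᵀ *
        hermD L (Equiv.prodUnique (Fin 1) (Fin 1)) (fun _ => (1 : L)) (fun _ => map_one _) (fun _ => (1 : L)) (fun _ => map_one _) * (S : Matrix (Fin 2) (Fin 2) L) =
      (StdForm.antidiagonal 2).over L)
    (γ : (quasiSplit (Fp L) L (IsCMField.complexConj L) 2).Rational) :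
    (adelicUnitaryGroupCongr L S _ _ hc ((quasiSplit (Fp L) L (IsCMField.complexConj L) 2).toAdelic γ) :
        HA L (Equiv.prodUnique (Fin 1) (Fin 1)) (fun _ => (1 : L)) (fun _ => map_one _) (fun _ => (1 : L)) (fun _ => map_one _)) ∈
      ratH L (Equiv.prodUnique (Fin 1) (Fin 1)) (fun _ => (1 : L)) (fun _ => map_one _) (fun _ => (1 : L)) (fun _ => map_one _) :=
  congr_toAdelic_mem_ratH L (antidiagOne_eq_over (L := L) (N := 2)) S hS hc γ

/-- **`Ψ_S⁻¹(δ) ∈ U(J₂)(L⁺)`** for `δ ∈ H₁(L⁺)`. [cite: PlatonovRapinchuk1994, §2.3] -/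
theorem bridgeOver_symm_mem_range_toAdelic
    (S : GL (Fin 2) L) (hS : (S : Matrix (Fin 2) (Fin 2) L) = !![1, 2⁻¹; 1, -2⁻¹])
    (hc : ((S : Matrix (Fin 2) (Fin 2) L).map (cmConjRingHom L))ᵀ *
        hermD L (Equiv.prodUnique (Fin 1) (Fin 1)) (fun _ => (1 : L)) (fun _ => map_one _) (fun _ => (1 : L)) (fun _ => map_one _) * (S : Matrix (Fin 2) (Fin 2) L) =
      (StdForm.antidiagonal 2).over L)
    {δ : HA L (Equiv.prodUnique (Fin 1) (Fin 1)) (fun _ => (1 : L)) (fun _ => map_one _) (fun _ => (1 : L)) (fun _ => map_one _)}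
    (hδ : δ ∈ ratH L (Equiv.prodUnique (Fin 1) (Fin 1)) (fun _ => (1 : L)) (fun _ => map_one _) (fun _ => (1 : L)) (fun _ => map_one _)) :
    ∃ γ : (quasiSplit (Fp L) L (IsCMField.complexConj L) 2).Rational,
      (quasiSplit (Fp L) L (IsCMField.complexConj L) 2).toAdelic γ = (adelicUnitaryGroupCongr L S _ _ hc).symm δ :=
  congr_symm_mem_range_toAdelic L (antidiagOne_eq_over (L := L) (N := 2)) S hS hc hδ

/-- **BOREL SECTIONS OF `U(J₂)` ARE SIEGEL SECTIONS OF THE DOUBLED LINE** (the `hF` of ★ `summable_borelSection_two` at parameter `s`): `F ∘ Ψ_S⁻¹ ∈ I_Δ(s, χ)`.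
[cite: Tan1999, §1] [cite: MoeglinWaldspurger1995, I.1.4, II.1.5] -/
theorem isSiegelDeltaSection_comp_bridgeOver_symm
    (S : GL (Fin 2) L) (hS : (S : Matrix (Fin 2) (Fin 2) L) = !![1, 2⁻¹; 1, -2⁻¹]) (hS' : ((S⁻¹ : GL (Fin 2) L) : Matrix (Fin 2) (Fin 2) L) = !![2⁻¹, 2⁻¹; 1, -1])
    (hc : ((S : Matrix (Fin 2) (Fin 2) L).map (cmConjRingHom L))ᵀ *
        hermD L (Equiv.prodUnique (Fin 1) (Fin 1)) (fun _ => (1 : L)) (fun _ => map_one _) (fun _ => (1 : L)) (fun _ => map_one _) * (S : Matrix (Fin 2) (Fin 2) L) =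
      (StdForm.antidiagonal 2).over L)
    (χ : HeckeCharacter L) (s : ℂ) {F : (quasiSplit (Fp L) L (IsCMField.complexConj L) 2).Adelic → ℂ}
    (hF : ∀ (b g : (quasiSplit (Fp L) L (IsCMField.complexConj L) 2).Adelic) (u : (AdeleRing (𝓞 L) L)ˣ),
      ((b.1 : GL (Fin 2) (AdeleRing (𝓞 L) L)) : Matrix (Fin 2) (Fin 2) (AdeleRing (𝓞 L) L)) 1 0 = 0 →
      (u : AdeleRing (𝓞 L) L) = ((b.1 : GL (Fin 2) (AdeleRing (𝓞 L) L)) : Matrix (Fin 2) (Fin 2) (AdeleRing (𝓞 L) L)) 0 0 →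
        F (b * g) = ((χ u : ℂˣ) : ℂ) * ((Real.sqrt (ideleNorm u) : ℝ) : ℂ) ^ (2 * s + 1) * F g) :
    IsSiegelDeltaSection L (Equiv.prodUnique (Fin 1) (Fin 1)) (fun _ => (1 : L)) (fun _ => map_one _) (fun _ => (1 : L)) (fun _ => map_one _) χ s
      (fun x => F ((adelicUnitaryGroupCongr L S _ _ hc).symm x)) :=
  isSiegelDeltaSection_comp_congr_symm L (antidiagOne_eq_over (L := L) (N := 2)) S hS hS' hc χ s hF

/-- **THE CARRIER IDENTITY ON `U(J₂)`: `eisensteinSeriesU F g = E^Δ_{n=1}(F ∘ Ψ_S⁻¹)(Ψ_S g)`** for every Borel section `F` of `I(s, χ)` of `U(J₂)(𝔸_{L⁺})`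
(the `hF` of ★ `summable_borelSection_two`) and every `g` (any `s`, `χ`; no convergence needed). [cite: Tan1999, §1] [cite: MoeglinWaldspurger1995, II.1.5] -/
theorem eisensteinSeriesU_eq_eisensteinSeriesDelta
    (S : GL (Fin 2) L) (hS : (S : Matrix (Fin 2) (Fin 2) L) = !![1, 2⁻¹; 1, -2⁻¹]) (hS' : ((S⁻¹ : GL (Fin 2) L) : Matrix (Fin 2) (Fin 2) L) = !![2⁻¹, 2⁻¹; 1, -1])
    (hc : ((S : Matrix (Fin 2) (Fin 2) L).map (cmConjRingHom L))ᵀ *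
        hermD L (Equiv.prodUnique (Fin 1) (Fin 1)) (fun _ => (1 : L)) (fun _ => map_one _) (fun _ => (1 : L)) (fun _ => map_one _) * (S : Matrix (Fin 2) (Fin 2) L) =
      (StdForm.antidiagonal 2).over L)
    (χ : HeckeCharacter L) (s : ℂ) {F : (quasiSplit (Fp L) L (IsCMField.complexConj L) 2).Adelic → ℂ}
    (hF : ∀ (b g : (quasiSplit (Fp L) L (IsCMField.complexConj L) 2).Adelic) (u : (AdeleRing (𝓞 L) L)ˣ),
      ((b.1 : GL (Fin 2) (AdeleRing (𝓞 L) L)) : Matrix (Fin 2) (Fin 2) (AdeleRing (𝓞 L) L)) 1 0 = 0 →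
      (u : AdeleRing (𝓞 L) L) = ((b.1 : GL (Fin 2) (AdeleRing (𝓞 L) L)) : Matrix (Fin 2) (Fin 2) (AdeleRing (𝓞 L) L)) 0 0 →
        F (b * g) = ((χ u : ℂˣ) : ℂ) * ((Real.sqrt (ideleNorm u) : ℝ) : ℂ) ^ (2 * s + 1) * F g)
    (g : (quasiSplit (Fp L) L (IsCMField.complexConj L) 2).Adelic) :
    eisensteinSeriesU F g =
      eisensteinSeriesDelta L (Equiv.prodUnique (Fin 1) (Fin 1)) (fun _ => (1 : L)) (fun _ => map_one _) (fun _ => (1 : L)) (fun _ => map_one _)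
        (fun x => F ((adelicUnitaryGroupCongr L S _ _ hc).symm x)) (adelicUnitaryGroupCongr L S _ _ hc g) :=
  eisensteinSeriesU_eq_eisensteinSeriesDelta_congr L (antidiagOne_eq_over (L := L) (N := 2)) S hS hS' hc χ s hF g

end Generic

/-! ## §4 The instance: term 2 of the Klingen constant term (★ F10) on the doubled line -/

section Transport

variable {L : Type} [Field L] [NumberField L] [IsCMField L] {N M : ℕ} {e : Fin N × Fin M ≃ Fin 2}
  {dV : Fin N → L} {hdV : ∀ i, IsCMField.complexConj L (dV i) = dV i} {dW : Fin M → L} {hdW : ∀ i, IsCMField.complexConj L (dW i) = dW i}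
  {SA : GL (Fin (2 + 2)) (AdeleRing (𝓞 L) L)}
  {Ψ : (quasiSplit (Fp L) L (IsCMField.complexConj L) (2 + 2)).Adelic ≃ₜ* HA L e dV hdV dW hdW} {X Y : Matrix (Fin 2) (Fin 2) (Fp L)} {a : Fp L}
  (hΨ : ∀ g : (quasiSplit (Fp L) L (IsCMField.complexConj L) (2 + 2)).Adelic,
    (((Ψ g : HA L e dV hdV dW hdW) : GL (Fin (2 + 2)) (AdeleRing (𝓞 L) L)) : Matrix (Fin (2 + 2)) (Fin (2 + 2)) (AdeleRing (𝓞 L) L)) =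
      (SA : Matrix (Fin (2 + 2)) (Fin (2 + 2)) (AdeleRing (𝓞 L) L)) *
        ((adelicVal (Fp L) L (IsCMField.complexConj L) (2 + 2) _ g : GL (Fin (2 + 2)) (AdeleRing (𝓞 L) L)) :
          Matrix (Fin (2 + 2)) (Fin (2 + 2)) (AdeleRing (𝓞 L) L)) *
        ((SA⁻¹ : GL (Fin (2 + 2)) (AdeleRing (𝓞 L) L)) : Matrix (Fin (2 + 2)) (Fin (2 + 2)) (AdeleRing (𝓞 L) L)))
  (ha : a + a = 1)
  (hSA : Matrix.reindex (e₂ (n := 2)).symm (e₂ (n := 2)).symm (SA : Matrix (Fin (2 + 2)) (Fin (2 + 2)) (AdeleRing (𝓞 L) L)) =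
    Matrix.fromBlocks (1 : Matrix (Fin 2) (Fin 2) (AdeleRing (𝓞 L) L)) (X.map ((algebraMap L (AdeleRing (𝓞 L) L)).comp (algebraMap (Fp L) L))) 1
      (-(X.map ((algebraMap L (AdeleRing (𝓞 L) L)).comp (algebraMap (Fp L) L)))))
  (hSAi : Matrix.reindex (e₂ (n := 2)).symm (e₂ (n := 2)).symm ((SA⁻¹ : GL (Fin (2 + 2)) (AdeleRing (𝓞 L) L)) : Matrix (Fin (2 + 2)) (Fin (2 + 2)) (AdeleRing (𝓞 L) L)) =
    Matrix.fromBlocks ((a • (1 : Matrix (Fin 2) (Fin 2) (Fp L))).map ((algebraMap L (AdeleRing (𝓞 L) L)).comp (algebraMap (Fp L) L)))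
      ((a • (1 : Matrix (Fin 2) (Fin 2) (Fp L))).map ((algebraMap L (AdeleRing (𝓞 L) L)).comp (algebraMap (Fp L) L)))
      (Y.map ((algebraMap L (AdeleRing (𝓞 L) L)).comp (algebraMap (Fp L) L)))
      (-(Y.map ((algebraMap L (AdeleRing (𝓞 L) L)).comp (algebraMap (Fp L) L)))))
  (hXY : X * Y = a • (1 : Matrix (Fin 2) (Fin 2) (Fp L))) (hYX : Y * X = a • (1 : Matrix (Fin 2) (Fin 2) (Fp L)))
  (hΨP : ∀ b : (quasiSplit (Fp L) L (IsCMField.complexConj L) (2 + 2)).Adelic,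
    ((adelicVal (Fp L) L (IsCMField.complexConj L) (2 + 2) _ b : GL (Fin (2 + 2)) (AdeleRing (𝓞 L) L)) :
        Matrix (Fin (2 + 2)) (Fin (2 + 2)) (AdeleRing (𝓞 L) L)).BlockTriangular id →
      IsSiegelDelta L e dV hdV dW hdW (Ψ b))

include hΨ ha hSA hSAi hΨP in
/-- **THE INNER SECTION OF TERM 2, PULLED BACK TO THE LINE, IS A SIEGEL SECTION OF `I_Δ(s − ½, χ)`**: for a continuous Siegel section `f ∈ I_Δ(s, χ)` of `H(𝔸)` and
`h ∈ H(𝔸)`, the section `F′_h(y) = ∫ f(Ψ(ξ^𝔸)·Ψ(n_Q(q.1,0,q.2))·Ψ(m_Q^𝔸(1, j₂⁻¹y))·h) d(μ_Y × μ_T)` of `U(J₂)(𝔸_{L⁺})` (★ F8's object; `μ_Y` left-invariant on the skew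
part `Y`, `μ_T` a Haar measure on `𝔸_L`) satisfies `F′_h ∘ Ψ_S⁻¹ ∈ I_Δ(s − ½, χ)` on the doubled line — ★ F8 `innerSection_borel_law` is exactly the Borel law at E1
parameter `s − ½`, and §3 `isSiegelDeltaSection_comp_bridgeOver_symm` transports it. [cite: MoeglinWaldspurger1995, II.1.7] [cite: Tan1999, §1] -/
theorem isSiegelDeltaSection_innerSection_comp_bridgeOver_symm [MeasurableSpace (AdeleRing (𝓞 L) L)] [BorelSpace (AdeleRing (𝓞 L) L)]
    [SecondCountableTopology (AdeleRing (𝓞 L) L)]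
    (Y : AddSubgroup (AdeleRing (𝓞 L) L)) (hY : ∀ y, y ∈ Y ↔ conjAdele (Fp L) L (IsCMField.complexConj L) y = -y)
    (μY : Measure ↥Y) (μT : Measure (AdeleRing (𝓞 L) L)) [SFinite μY] [SFinite μT] [μY.IsAddLeftInvariant] [μT.IsAddHaarMeasure]
    {χ : HeckeCharacter L} {s : ℂ} {f : HA L e dV hdV dW hdW → ℂ} (hf : IsSiegelDeltaSection L e dV hdV dW hdW χ s f) (hfc : Continuous f) (h : HA L e dV hdV dW hdW)
    (S : GL (Fin 2) L) (hS : (S : Matrix (Fin 2) (Fin 2) L) = !![1, 2⁻¹; 1, -2⁻¹]) (hS' : ((S⁻¹ : GL (Fin 2) L) : Matrix (Fin 2) (Fin 2) L) = !![2⁻¹, 2⁻¹; 1, -1])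
    (hc : ((S : Matrix (Fin 2) (Fin 2) L).map (cmConjRingHom L))ᵀ *
        hermD L (Equiv.prodUnique (Fin 1) (Fin 1)) (fun _ => (1 : L)) (fun _ => map_one _) (fun _ => (1 : L)) (fun _ => map_one _) * (S : Matrix (Fin 2) (Fin 2) L) =
      (StdForm.antidiagonal 2).over L) :
    IsSiegelDeltaSection L (Equiv.prodUnique (Fin 1) (Fin 1)) (fun _ => (1 : L)) (fun _ => map_one _) (fun _ => (1 : L)) (fun _ => map_one _) χ (s - 1 / 2)
      (fun x => (fun y : (quasiSplit (Fp L) L (IsCMField.complexConj L) 2).Adelic =>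
          ∫ q : ↥Y × AdeleRing (𝓞 L) L, f (Ψ (jAdelic L 4 (weylXi (AdeleRing (𝓞 L) L) (conjAdele (Fp L) L (IsCMField.complexConj L)))) *
            Ψ (jAdelic L 4 (nKlingen (AdeleRing (𝓞 L) L) (conjAdele (Fp L) L (IsCMField.complexConj L)) (conjAdele_conjAdele' L) (((q.1 : ↥Y) : AdeleRing (𝓞 L) L)) ((hY _).1 q.1.2) 0 (q.2))) *
            (Ψ (jAdelic L 4 (klingenLevi (AdeleRing (𝓞 L) L) (conjAdele (Fp L) L (IsCMField.complexConj L)) (conjAdele_conjAdele' L) 1 ((jAdelic L 2).symm y))) * h)) ∂(μY.prod μT))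
        ((adelicUnitaryGroupCongr L S _ _ hc).symm x)) :=
  isSiegelDeltaSection_comp_bridgeOver_symm L S hS hS' hc χ (s - 1 / 2)
    (F := fun y : (quasiSplit (Fp L) L (IsCMField.complexConj L) 2).Adelic =>
      ∫ q : ↥Y × AdeleRing (𝓞 L) L, f (Ψ (jAdelic L 4 (weylXi (AdeleRing (𝓞 L) L) (conjAdele (Fp L) L (IsCMField.complexConj L)))) *
        Ψ (jAdelic L 4 (nKlingen (AdeleRing (𝓞 L) L) (conjAdele (Fp L) L (IsCMField.complexConj L)) (conjAdele_conjAdele' L) (((q.1 : ↥Y) : AdeleRing (𝓞 L) L)) ((hY _).1 q.1.2) 0 (q.2))) *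
        (Ψ (jAdelic L 4 (klingenLevi (AdeleRing (𝓞 L) L) (conjAdele (Fp L) L (IsCMField.complexConj L)) (conjAdele_conjAdele' L) 1 ((jAdelic L 2).symm y))) * h)) ∂(μY.prod μT))
    (fun b g u hb hu => innerSection_borel_law hΨ ha hSA hSAi hΨP Y hY μY μT hf hfc h b g u hb hu)

include hΨ ha hSA hSAi hΨP in
/-- **`E_B(F′_h)(g₂) = E^Δ_{n=1}(F′_h ∘ Ψ_S⁻¹)(Ψ_S g₂)`** — the Borel Eisenstein series of `U(J₂)` of the inner section of term 2 IS the Siegel–hermitian Eisenstein series of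
the doubled line of its pull-back (§3 `eisensteinSeriesU_eq_eisensteinSeriesDelta` with ★ F8's law; any `s`, no convergence needed). [cite: MoeglinWaldspurger1995, II.1.5, II.1.7]
[cite: Tan1999, §1] -/
theorem eisensteinSeriesU_innerSection_eq_eisensteinSeriesDelta [MeasurableSpace (AdeleRing (𝓞 L) L)] [BorelSpace (AdeleRing (𝓞 L) L)]
    [SecondCountableTopology (AdeleRing (𝓞 L) L)]
    (Y : AddSubgroup (AdeleRing (𝓞 L) L)) (hY : ∀ y, y ∈ Y ↔ conjAdele (Fp L) L (IsCMField.complexConj L) y = -y)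
    (μY : Measure ↥Y) (μT : Measure (AdeleRing (𝓞 L) L)) [SFinite μY] [SFinite μT] [μY.IsAddLeftInvariant] [μT.IsAddHaarMeasure]
    {χ : HeckeCharacter L} {s : ℂ} {f : HA L e dV hdV dW hdW → ℂ} (hf : IsSiegelDeltaSection L e dV hdV dW hdW χ s f) (hfc : Continuous f) (h : HA L e dV hdV dW hdW)
    (S : GL (Fin 2) L) (hS : (S : Matrix (Fin 2) (Fin 2) L) = !![1, 2⁻¹; 1, -2⁻¹]) (hS' : ((S⁻¹ : GL (Fin 2) L) : Matrix (Fin 2) (Fin 2) L) = !![2⁻¹, 2⁻¹; 1, -1])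
    (hc : ((S : Matrix (Fin 2) (Fin 2) L).map (cmConjRingHom L))ᵀ *
        hermD L (Equiv.prodUnique (Fin 1) (Fin 1)) (fun _ => (1 : L)) (fun _ => map_one _) (fun _ => (1 : L)) (fun _ => map_one _) * (S : Matrix (Fin 2) (Fin 2) L) =
      (StdForm.antidiagonal 2).over L)
    (g₂ : (quasiSplit (Fp L) L (IsCMField.complexConj L) 2).Adelic) :
    eisensteinSeriesU (fun y : (quasiSplit (Fp L) L (IsCMField.complexConj L) 2).Adelic =>
        ∫ q : ↥Y × AdeleRing (𝓞 L) L, f (Ψ (jAdelic L 4 (weylXi (AdeleRing (𝓞 L) L) (conjAdele (Fp L) L (IsCMField.complexConj L)))) *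
          Ψ (jAdelic L 4 (nKlingen (AdeleRing (𝓞 L) L) (conjAdele (Fp L) L (IsCMField.complexConj L)) (conjAdele_conjAdele' L) (((q.1 : ↥Y) : AdeleRing (𝓞 L) L)) ((hY _).1 q.1.2) 0 (q.2))) *
          (Ψ (jAdelic L 4 (klingenLevi (AdeleRing (𝓞 L) L) (conjAdele (Fp L) L (IsCMField.complexConj L)) (conjAdele_conjAdele' L) 1 ((jAdelic L 2).symm y))) * h)) ∂(μY.prod μT)) g₂ =
      eisensteinSeriesDelta L (Equiv.prodUnique (Fin 1) (Fin 1)) (fun _ => (1 : L)) (fun _ => map_one _) (fun _ => (1 : L)) (fun _ => map_one _)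
        (fun x => (fun y : (quasiSplit (Fp L) L (IsCMField.complexConj L) 2).Adelic =>
            ∫ q : ↥Y × AdeleRing (𝓞 L) L, f (Ψ (jAdelic L 4 (weylXi (AdeleRing (𝓞 L) L) (conjAdele (Fp L) L (IsCMField.complexConj L)))) *
              Ψ (jAdelic L 4 (nKlingen (AdeleRing (𝓞 L) L) (conjAdele (Fp L) L (IsCMField.complexConj L)) (conjAdele_conjAdele' L) (((q.1 : ↥Y) : AdeleRing (𝓞 L) L)) ((hY _).1 q.1.2) 0 (q.2))) *
              (Ψ (jAdelic L 4 (klingenLevi (AdeleRing (𝓞 L) L) (conjAdele (Fp L) L (IsCMField.complexConj L)) (conjAdele_conjAdele' L) 1 ((jAdelic L 2).symm y))) * h)) ∂(μY.prod μT))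
          ((adelicUnitaryGroupCongr L S _ _ hc).symm x))
        (adelicUnitaryGroupCongr L S _ _ hc g₂) :=
  eisensteinSeriesU_eq_eisensteinSeriesDelta L S hS hS' hc χ (s - 1 / 2)
    (fun b g u hb hu => innerSection_borel_law hΨ ha hSA hSAi hΨP Y hY μY μT hf hfc h b g u hb hu) g₂

include hΨ ha hSA hSAi hΨP hXY hYX in
/-- **THE CARRIER LETTER (A) FOR ★ F10's TERM 2: `T₂ = eisensteinSeriesU F_h g₂ = C · E^Δ_{n=1}(F′_h ∘ Ψ_S⁻¹)(Ψ_S g₂)`** for F10's OWN section (orbit form)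
`F_h(y) = ∫ β₁(u) • f(Ψ(ξ^L)·u·Ψ(m_Q^𝔸(1, j₂⁻¹y))·h) dνN(u)`, with ONE constant `C ≠ ∞` for all `h ∈ H(𝔸)` and all `g₂ ∈ U(J₂)(𝔸_{L⁺})` (★ F5-q
`exists_const_innerSectionOrbit_eq`: `F_h = C · F′_h`; ★ F5-p `toAdelic_weylXi_eq_jAdelic`; ★ E1 `eisensteinSeriesU_smul`; then `eisensteinSeriesU_innerSection_eq_eisensteinSeriesDelta`).
Binders = ★ F5-q's (Haar `νN` on `N_Q(𝔸)`, additive Haar measures `μ_Z, μ_Y, μ_T`, the stabiliser lattice `Γ₁` with a `Γ₁`-covering weight `β₁`, a measurable `ι(L)`-covering weight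
`β₀` on `𝔸_L` of finite mass, `f` a continuous Siegel section, integrability `hint` of the orbit integrand) + the pinned congruence `S`.
[cite: MoeglinWaldspurger1995, II.1.5, II.1.7] [cite: GanTakeda2011SiegelWeil, §7.2 p. 23] [cite: Tan1999, §1] -/
theorem exists_const_eisensteinSeriesU_innerSectionOrbit_eq [MeasurableSpace (AdeleRing (𝓞 L) L)] [BorelSpace (AdeleRing (𝓞 L) L)]
    [SecondCountableTopology (AdeleRing (𝓞 L) L)]
    [MeasurableSpace ↥(klingenUnipA Ψ)] [BorelSpace ↥(klingenUnipA Ψ)] [LocallyCompactSpace ↥(klingenUnipA Ψ)] [SecondCountableTopology ↥(klingenUnipA Ψ)]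
    (νN : Measure ↥(klingenUnipA Ψ)) [νN.IsHaarMeasure]
    (Y : AddSubgroup (AdeleRing (𝓞 L) L)) (hY : ∀ y, y ∈ Y ↔ conjAdele (Fp L) L (IsCMField.complexConj L) y = -y)
    (μZ : Measure (AdeleRing (𝓞 L) L)) (μY : Measure ↥Y) (μT : Measure (AdeleRing (𝓞 L) L)) [SFinite μZ] [SFinite μY] [SFinite μT]
    [μZ.IsAddHaarMeasure] [μY.IsAddHaarMeasure] [μT.IsAddHaarMeasure]
    (Γ₁ : Subgroup ↥(klingenUnipA Ψ))
    (hΓ₁ : ∀ u : ↥(klingenUnipA Ψ), u ∈ Γ₁ ↔ (u : HA L e dV hdV dW hdW) ∈ ratH L e dV hdV dW hdW ∧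
      IsSiegelDelta L e dV hdV dW hdW (Ψ (UnitaryGroup.toAdelic (Fp L) L (IsCMField.complexConj L) (2 + 2) ((StdForm.antidiagonal (2 + 2)).over L) (weylXi L ((IsCMField.complexConj L : L ≃ₐ[Fp L] L) : L →+* L))) * (u : HA L e dV hdV dW hdW) * (Ψ (UnitaryGroup.toAdelic (Fp L) L (IsCMField.complexConj L) (2 + 2) ((StdForm.antidiagonal (2 + 2)).over L) (weylXi L ((IsCMField.complexConj L : L ≃ₐ[Fp L] L) : L →+* L))))⁻¹))
    {β₁ : ↥(klingenUnipA Ψ) → ℝ≥0∞} (hβ₁ : IsCoveringWeight ↥Γ₁ β₁)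
    {β₀ : AdeleRing (𝓞 L) L → ℝ≥0∞} (hβ₀m : Measurable β₀) (hβ₀ : ∀ z, ∑' l : ↥((algebraMap L (AdeleRing (𝓞 L) L)).toAddMonoidHom.range), β₀ ((l : AdeleRing (𝓞 L) L) + z) = 1)
    (hβ₀fin : ∫⁻ z, β₀ z ∂μZ ≠ ∞)
    {χ : HeckeCharacter L} {s : ℂ} {f : HA L e dV hdV dW hdW → ℂ} (hf : IsSiegelDeltaSection L e dV hdV dW hdW χ s f) (hfc : Continuous f)
    (hint : ∀ x : HA L e dV hdV dW hdW, Integrable (fun u : ↥(klingenUnipA Ψ) => (β₁ u).toReal • f (Ψ (jAdelic L 4 (weylXi (AdeleRing (𝓞 L) L) (conjAdele (Fp L) L (IsCMField.complexConj L)))) * (u : HA L e dV hdV dW hdW) * x)) νN)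
    (S : GL (Fin 2) L) (hS : (S : Matrix (Fin 2) (Fin 2) L) = !![1, 2⁻¹; 1, -2⁻¹]) (hS' : ((S⁻¹ : GL (Fin 2) L) : Matrix (Fin 2) (Fin 2) L) = !![2⁻¹, 2⁻¹; 1, -1])
    (hc : ((S : Matrix (Fin 2) (Fin 2) L).map (cmConjRingHom L))ᵀ *
        hermD L (Equiv.prodUnique (Fin 1) (Fin 1)) (fun _ => (1 : L)) (fun _ => map_one _) (fun _ => (1 : L)) (fun _ => map_one _) * (S : Matrix (Fin 2) (Fin 2) L) =
      (StdForm.antidiagonal 2).over L) :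
    ∃ C : ℝ≥0∞, C ≠ ∞ ∧ ∀ (h : HA L e dV hdV dW hdW) (g₂ : (quasiSplit (Fp L) L (IsCMField.complexConj L) 2).Adelic),
      eisensteinSeriesU (fun y : (quasiSplit (Fp L) L (IsCMField.complexConj L) 2).Adelic =>
          ∫ u, (β₁ u).toReal • f (Ψ (UnitaryGroup.toAdelic (Fp L) L (IsCMField.complexConj L) (2 + 2) ((StdForm.antidiagonal (2 + 2)).over L) (weylXi L ((IsCMField.complexConj L : L ≃ₐ[Fp L] L) : L →+* L))) * (u : HA L e dV hdV dW hdW) *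
            (Ψ (jAdelic L 4 (klingenLevi (AdeleRing (𝓞 L) L) (conjAdele (Fp L) L (IsCMField.complexConj L)) (conjAdele_conjAdele' L) 1 ((jAdelic L 2).symm y))) * h)) ∂νN) g₂ =
        C.toReal *
          eisensteinSeriesDelta L (Equiv.prodUnique (Fin 1) (Fin 1)) (fun _ => (1 : L)) (fun _ => map_one _) (fun _ => (1 : L)) (fun _ => map_one _)
            (fun x => (fun y : (quasiSplit (Fp L) L (IsCMField.complexConj L) 2).Adelic =>
                ∫ q : ↥Y × AdeleRing (𝓞 L) L, f (Ψ (jAdelic L 4 (weylXi (AdeleRing (𝓞 L) L) (conjAdele (Fp L) L (IsCMField.complexConj L)))) *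
                  Ψ (jAdelic L 4 (nKlingen (AdeleRing (𝓞 L) L) (conjAdele (Fp L) L (IsCMField.complexConj L)) (conjAdele_conjAdele' L) (((q.1 : ↥Y) : AdeleRing (𝓞 L) L)) ((hY _).1 q.1.2) 0 (q.2))) *
                  (Ψ (jAdelic L 4 (klingenLevi (AdeleRing (𝓞 L) L) (conjAdele (Fp L) L (IsCMField.complexConj L)) (conjAdele_conjAdele' L) 1 ((jAdelic L 2).symm y))) * h)) ∂(μY.prod μT))
              ((adelicUnitaryGroupCongr L S _ _ hc).symm x))
            (adelicUnitaryGroupCongr L S _ _ hc g₂) := by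
  obtain ⟨C, hCtop, hC⟩ := exists_const_innerSectionOrbit_eq hΨ ha hSA hSAi hXY hYX hΨP νN Y hY μZ μY μT Γ₁ hΓ₁ hβ₁ hβ₀m hβ₀ hβ₀fin hf hfc hint
  refine ⟨C, hCtop, fun h g₂ => ?_⟩
  have hF : (fun y : (quasiSplit (Fp L) L (IsCMField.complexConj L) 2).Adelic =>
        ∫ u, (β₁ u).toReal • f (Ψ (UnitaryGroup.toAdelic (Fp L) L (IsCMField.complexConj L) (2 + 2) ((StdForm.antidiagonal (2 + 2)).over L) (weylXi L ((IsCMField.complexConj L : L ≃ₐ[Fp L] L) : L →+* L))) * (u : HA L e dV hdV dW hdW) *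
          (Ψ (jAdelic L 4 (klingenLevi (AdeleRing (𝓞 L) L) (conjAdele (Fp L) L (IsCMField.complexConj L)) (conjAdele_conjAdele' L) 1 ((jAdelic L 2).symm y))) * h)) ∂νN) =
      (C.toReal : ℂ) • (fun y : (quasiSplit (Fp L) L (IsCMField.complexConj L) 2).Adelic =>
        ∫ q : ↥Y × AdeleRing (𝓞 L) L, f (Ψ (jAdelic L 4 (weylXi (AdeleRing (𝓞 L) L) (conjAdele (Fp L) L (IsCMField.complexConj L)))) *
          Ψ (jAdelic L 4 (nKlingen (AdeleRing (𝓞 L) L) (conjAdele (Fp L) L (IsCMField.complexConj L)) (conjAdele_conjAdele' L) (((q.1 : ↥Y) : AdeleRing (𝓞 L) L)) ((hY _).1 q.1.2) 0 (q.2))) *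
          (Ψ (jAdelic L 4 (klingenLevi (AdeleRing (𝓞 L) L) (conjAdele (Fp L) L (IsCMField.complexConj L)) (conjAdele_conjAdele' L) 1 ((jAdelic L 2).symm y))) * h)) ∂(μY.prod μT)) := by
    funext y
    rw [Pi.smul_apply, smul_eq_mul, toAdelic_weylXi_eq_jAdelic, hC]
  rw [hF, eisensteinSeriesU_smul, eisensteinSeriesU_innerSection_eq_eisensteinSeriesDelta hΨ ha hSA hSAi hΨP Y hY μY μT hf hfc h S hS hS' hc g₂]

end Transport

end Summit.HodgeConjecture.HodgeConjecture.Cruxes.HLiu418.K2LiuKlingenTermTwoTransport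

end
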